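import Mathlib
import Summits.CriticalPhenomena.CardyFormulaZ2.Theorems.CardyMagicRigidityPositiveConeDefs
import Summits.CriticalPhenomena.CardyFormulaZ2.Theorems.CardyMagicRigidityNestingRigidityTowerCountMeasurable
import Summits.CriticalPhenomena.CardyFormulaZ2.Theorems.CardyMagicRigidityNestingRigidityTowerPressureSanity
import Summits.CriticalPhenomena.CardyFormulaZ2.Theorems.CardyMagicRigidityNestingRigidityPgfIdentity
import Literature.Probability.Percolation.FKLoopNestingIntegrable
import Literature.Probability.Percolation.SiteNestingWeightBound
import HarnessLib

/-!
# Stub `stub_pgfUniqueness` (line `positive-cone-weight-doubling`, crux `NestingRigidity`)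

Crux `Summit.CriticalPhenomena.CardyFormulaZ2.Theses.CardyMagicRigidity.NestingRigidity`
(stmt-CriticalPhenomena-4835), line `positive-cone-weight-doubling`, registered stub
`stub_pgfUniqueness : ∀ n x r R, TiltAgreementAt n x r R → LawAgreementAt n x r R` (STUB 4,
`PGFUniqueness`): if the positively TILTED multi-disc pattern-count moments
`E_δ[∏_{S ≠ ∅} u_S^{N_S}]` of bond-`ℤ²` and site-`𝕋` are eventually bounded and asymptotically equal
(`δ → 0⁺`) for all weight vectors `u` in a non-empty open set of positive vectors, then every cylinder
probability of the count vector `(N_S)_{S ≠ ∅}` is asymptotically equal on the two lattices.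

* §1 `exists_patternCount_le` — at positive mesh the pattern counts are bounded uniformly in the
  configuration (a counted loop has its trace in the window, hence meets `B̄(0, R)`; boundedly many
  loops of either lattice do: `ncard_loops_meeting_le`, `ncard_loops_siteLoopConfig_meeting_le`), so
  the tilted moments are honest expectations;
* §2 `integral_prod_pow_eq_tsum` — for a bounded measurable count vector `N : Ω → ℕ^ι` on a
  probability space, `E[∏ i, v i ^ N i] = Σ_κ P[N = κ] v^κ` (a finite sum); `tilt_eq_tsum` — the
  tilted moment `tilt E x r R w δ` is the generating function of the cylinder probabilities of
  `(N_S)_{S ∈ nonemptyParts n}`;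
* §3 the stub: along every sequence `δ_j → 0⁺` (`Filter.tendsto_of_seq_tendsto`) the cylinder
  probabilities of the two lattices are `[0,1]`-valued coefficient families whose generating
  functions are eventually bounded and asymptotically equal on the open set
  `{v | ext v ∈ U} ⊆ ℝ^{nonemptyParts n}`; the analytic core `tendsto_coeff_sub_of_tsum`
  (`CardyMagicRigidityNestingRigidityPgfIdentity`: subsequential limits, dominated convergence below a
  point of `U`, identity theorem for non-negative power series) gives coefficientwise asymptotic
  agreement.
-/

noncomputable section

open MeasureTheory Set Filter Metric
open scoped Real Topology BigOperators ENNReal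

namespace Summit.CriticalPhenomena.CardyFormulaZ2.Cruxes.NestingRigidity.PositiveConeWeightDoubling

open Literature.Probability.RandomPlanarGeometry Literature.Probability.Percolation
  Literature.Probability.LatticeModels
open Summit.CriticalPhenomena.CardyFormulaZ2.Theses.CardyMagicRigidity
open Summit.CriticalPhenomena.CardyFormulaZ2.Cruxes.NestingRigidity.RingCloudTomography

/-! ## §1 Pattern counts are bounded at positive mesh -/

/-- **At positive mesh the pattern counts are bounded uniformly in the configuration**: a counted
loop has its (non-empty) trace inside the window `B(0, R)`, hence meets `B̄(0, R)`, and at most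
`N(δ, R)` loops of bond-`ℤ²` (`ncard_loops_meeting_le`) resp. site-`𝕋`
(`ncard_loops_siteLoopConfig_meeting_le`) do. -/
theorem exists_patternCount_le : ∀ E ∈ latticeEnsembles, ∀ {δ : ℝ}, 0 < δ → ∀ R : ℝ, ∃ C : ℕ,
    ∀ (ω : E.Ω) {n : ℕ} (z : Fin n → ℂ) (r : Fin n → ℝ) (S : Finset (Fin n)),
      patternCount (E.X δ ω) z r R S ≤ C := by
  intro E hE δ hδ R
  have key : ∀ (c : LoopConfig ℂ) {n : ℕ} (z : Fin n → ℂ) (r : Fin n → ℝ) (S : Finset (Fin n)),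
      {u ∈ c.loops | (u.range ∩ closedBall (0 : ℂ) R).Nonempty}.Finite →
        patternCount c z r R S ≤ {u ∈ c.loops | (u.range ∩ closedBall (0 : ℂ) R).Nonempty}.ncard := by
    intro c n z r S hfin
    refine Set.ncard_le_ncard (fun u hu ↦ ⟨hu.1, ?_⟩) hfin
    obtain ⟨p, hp⟩ := u.range_nonempty
    exact ⟨p, hp, ball_subset_closedBall (hu.2.1 hp)⟩
  simp only [latticeEnsembles, Set.mem_insert_iff, Set.mem_singleton_iff] at hE
  rcases hE with rfl | rfl
  · exact ⟨_, fun ω n z r S ↦ (key _ z r S (ncard_loops_meeting_le hδ R ω).1).trans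
      (ncard_loops_meeting_le hδ R ω).2⟩
  · exact ⟨_, fun ω n z r S ↦ (key _ z r S (ncard_loops_siteLoopConfig_meeting_le hδ R ω).1).trans
      (ncard_loops_siteLoopConfig_meeting_le hδ R ω).2⟩

/-! ## §2 Tilted moments are generating functions of cylinder probabilities -/

/-- The cylinder events of a measurable count vector are measurable. -/
theorem measurableSet_cylinder {Ω ι : Type*} [MeasurableSpace Ω] [Countable ι] {N : Ω → ι → ℕ}
    (hN : ∀ i, Measurable fun ω ↦ N ω i) (κ : ι → ℕ) : MeasurableSet {ω | ∀ i, N ω i = κ i} := by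
  rw [Set.setOf_forall]
  exact MeasurableSet.iInter fun i ↦ hN i (measurableSet_singleton (κ i))

/-- **Law of a bounded count vector**: for a measurable, bounded `N : Ω → ℕ^ι` on a probability
space, `E[∏ i, v i ^ N i] = Σ_κ P[N = κ] ∏ i, v i ^ κ i`, the family on the right being finitely
supported (hence summable for every `v`). -/
theorem integral_prod_pow_eq_tsum {Ω ι : Type*} [MeasurableSpace Ω] [Fintype ι] (P : Measure Ω)
    [IsProbabilityMeasure P] {N : Ω → ι → ℕ} (hN : ∀ i, Measurable fun ω ↦ N ω i) {C : ℕ}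
    (hC : ∀ ω i, N ω i ≤ C) (v : ι → ℝ) :
    Summable (fun κ : ι → ℕ ↦ (P {ω | ∀ i, N ω i = κ i}).toReal * ∏ i, v i ^ κ i) ∧
      ∫ ω, ∏ i, v i ^ N ω i ∂P = ∑' κ : ι → ℕ, (P {ω | ∀ i, N ω i = κ i}).toReal * ∏ i, v i ^ κ i := by
  classical
  set K : Finset (ι → ℕ) := Fintype.piFinset fun _ ↦ Finset.range (C + 1) with hK
  have hmem : ∀ ω, N ω ∈ K := fun ω ↦
    Fintype.mem_piFinset.2 fun i ↦ Finset.mem_range.2 (Nat.lt_succ_of_le (hC ω i))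
  have hzero : ∀ κ ∉ K, (P {ω | ∀ i, N ω i = κ i}).toReal * ∏ i, v i ^ κ i = 0 := by
    intro κ hκ
    have : {ω | ∀ i, N ω i = κ i} = ∅ := by
      ext ω
      simp only [Set.mem_setOf_eq, Set.mem_empty_iff_false, iff_false]
      exact fun hω ↦ hκ (funext hω ▸ hmem ω)
    rw [this, measure_empty, ENNReal.toReal_zero, zero_mul]
  refine ⟨summable_of_ne_finset_zero hzero, ?_⟩
  -- pointwise: the integrand is a finite sum of indicators
  have hpt : ∀ ω, ∏ i, v i ^ N ω i =
      ∑ κ ∈ K, {ω | ∀ i, N ω i = κ i}.indicator (fun _ ↦ ∏ i, v i ^ κ i) ω := by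
    intro ω
    rw [Finset.sum_eq_single_of_mem (N ω) (hmem ω) fun κ _ hκ ↦ ?_]
    · rw [Set.indicator_of_mem (show ω ∈ {ω' | ∀ i, N ω' i = N ω i} from fun _ ↦ rfl)]
    · exact Set.indicator_of_notMem
        (fun h : ω ∈ {ω' | ∀ i, N ω' i = κ i} ↦ hκ (funext fun i ↦ h i).symm) _
  calc ∫ ω, ∏ i, v i ^ N ω i ∂P
      = ∫ ω, ∑ κ ∈ K, {ω | ∀ i, N ω i = κ i}.indicator (fun _ ↦ ∏ i, v i ^ κ i) ω ∂P :=
        integral_congr_ae (Eventually.of_forall hpt)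
    _ = ∑ κ ∈ K, ∫ ω, {ω | ∀ i, N ω i = κ i}.indicator (fun _ ↦ ∏ i, v i ^ κ i) ω ∂P :=
        integral_finsetSum K fun κ _ ↦ (integrable_const _).indicator (measurableSet_cylinder hN κ)
    _ = ∑ κ ∈ K, (P {ω | ∀ i, N ω i = κ i}).toReal * ∏ i, v i ^ κ i :=
        Finset.sum_congr rfl fun κ _ ↦ by
          rw [integral_indicator_const _ (measurableSet_cylinder hN κ), measureReal_def, smul_eq_mul]
    _ = ∑' κ : ι → ℕ, (P {ω | ∀ i, N ω i = κ i}).toReal * ∏ i, v i ^ κ i := (tsum_eq_sum hzero).symm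

/-- **The tilted moment is the generating function of the cylinder probabilities** of the count
vector `(N_S)_{S ∈ nonemptyParts n}`, at every positive mesh, on both lattice ensembles (and the
coefficient family is summable against every weight vector). -/
theorem tilt_eq_tsum : ∀ E ∈ latticeEnsembles, ∀ {δ : ℝ}, 0 < δ →
    ∀ {n : ℕ} (x : Fin n → ℂ) (r : Fin n → ℝ) (R : ℝ) (w : Finset (Fin n) → ℝ),
      Summable (fun κ : nonemptyParts n → ℕ ↦ (E.P {ω | ∀ i : nonemptyParts n,
          patternCount (E.X δ ω) x r R i = κ i}).toReal * ∏ i : nonemptyParts n, w i ^ κ i) ∧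
        tilt E x r R w δ = ∑' κ : nonemptyParts n → ℕ, (E.P {ω | ∀ i : nonemptyParts n,
          patternCount (E.X δ ω) x r R i = κ i}).toReal * ∏ i : nonemptyParts n, w i ^ κ i := by
  intro E hE δ hδ n x r R w
  haveI : IsProbabilityMeasure E.P := isProbabilityMeasure_of_mem hE
  obtain ⟨C, hC⟩ := exists_patternCount_le E hE hδ R
  have h := integral_prod_pow_eq_tsum E.P (N := fun ω (i : nonemptyParts n) ↦
    patternCount (E.X δ ω) x r R i) (fun i ↦ measurable_patternCount E hE δ x r R i)
    (fun ω i ↦ hC ω x r i) (fun i ↦ w i)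
  refine ⟨h.1, ?_⟩
  rw [← h.2, tilt]
  exact integral_congr_ae (Eventually.of_forall fun ω ↦ (Finset.prod_coe_sort (nonemptyParts n)
    (fun S ↦ w S ^ patternCount (E.X δ ω) x r R S)).symm)

/-- The cylinder event of `cyl` (quantified over non-empty `S`) is the cylinder event of the count
vector indexed by `nonemptyParts n`. -/
theorem setOf_forall_nonempty_eq {α : Type*} {n : ℕ} (Q : α → Finset (Fin n) → Prop) :
    {ω | ∀ S : Finset (Fin n), S.Nonempty → Q ω S} = {ω | ∀ i : nonemptyParts n, Q ω i} := by
  ext ω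
  simp only [Set.mem_setOf_eq, nonemptyParts, Finset.mem_filter, Finset.mem_univ, true_and,
    Subtype.forall]

/-! ## §3 The stub -/

/-- **STUB 4 · PGF uniqueness in limit form** (registered stub of line
`positive-cone-weight-doubling`): if the positively tilted multi-disc pattern-count moments of
bond-`ℤ²` and site-`𝕋` are eventually bounded and asymptotically equal, as `δ → 0⁺`, for all weight
vectors in a non-empty open set of positive vectors, then every cylinder probability of
`(N_S)_{S ≠ ∅}` is asymptotically equal.  Proof: reduce to sequences `δ_j → 0⁺`; by §1–§2 the tilted
moments are the generating functions `Σ_κ P[N = κ] v^κ` of the `[0,1]`-valued cylinder probabilities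
(weights indexed by `nonemptyParts n`, extended to all index sets by a fixed `u₀ ∈ U` off the
non-empty ones — the tilt does not see those coordinates); the analytic core
`tendsto_coeff_sub_of_tsum` concludes. -/
theorem stub_pgfUniqueness : ∀ (n : ℕ) (x : Fin n → ℂ) (r : Fin n → ℝ) (R : ℝ),
    TiltAgreementAt n x r R → LawAgreementAt n x r R := by
  intro n x r R hT k
  obtain ⟨U, hUo, ⟨u₀, hu₀⟩, hUpos, hU⟩ := hT
  classical
  -- weight vectors indexed by the non-empty parts, extended by `u₀` elsewhere
  set ext : (nonemptyParts n → ℝ) → (Finset (Fin n) → ℝ) :=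
    fun v S ↦ if h : S ∈ nonemptyParts n then v ⟨S, h⟩ else u₀ S with hext
  have hext_cont : Continuous ext := continuous_pi fun S ↦ by
    by_cases h : S ∈ nonemptyParts n
    · simp only [hext, dif_pos h]; exact continuous_apply _
    · simp only [hext, dif_neg h]; exact continuous_const
  have hext_apply : ∀ (v : nonemptyParts n → ℝ) (i : nonemptyParts n), ext v i = v i :=
    fun v i ↦ by simp only [hext, dif_pos i.2, Subtype.coe_eta]
  set U' : Set (nonemptyParts n → ℝ) := ext ⁻¹' U with hU'
  have hU'o : IsOpen U' := hUo.preimage hext_cont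
  have hU'ne : U'.Nonempty := by
    have hv₀ : ext (fun i ↦ u₀ i) = u₀ := by
      funext S
      simp only [hext]
      split_ifs <;> rfl
    exact ⟨fun i ↦ u₀ i, Set.mem_preimage.2 (by rw [hv₀]; exact hu₀)⟩
  have hU'pos : ∀ v ∈ U', ∀ i, 0 < v i := fun v hv i ↦ by
    rw [← hext_apply v i]; exact hUpos _ hv _
  -- along a sequence of meshes `δs j → 0⁺`
  refine tendsto_of_seq_tendsto fun δs hδs ↦ ?_
  have hpos : ∀ᶠ j in atTop, δs j ∈ Ioi (0 : ℝ) := hδs.eventually eventually_mem_nhdsWithin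
  -- the cylinder probabilities as coefficient families
  set a : ℕ → (nonemptyParts n → ℕ) → ℝ := fun j κ ↦ (zEns.P {ω | ∀ i : nonemptyParts n,
    patternCount (zEns.X (δs j) ω) x r R i = κ i}).toReal with ha
  set b : ℕ → (nonemptyParts n → ℕ) → ℝ := fun j κ ↦ (tEns.P {ω | ∀ i : nonemptyParts n,
    patternCount (tEns.X (δs j) ω) x r R i = κ i}).toReal with hb
  haveI : IsProbabilityMeasure zEns.P := isProbabilityMeasure_of_mem zEns_mem
  haveI : IsProbabilityMeasure tEns.P := isProbabilityMeasure_of_mem tEns_mem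
  have hle1 : ∀ {Ω : Type} [MeasurableSpace Ω] (P : Measure Ω) [IsProbabilityMeasure P]
      (s : Set Ω), (P s).toReal ≤ 1 :=
    fun P _ s ↦ (ENNReal.toReal_mono ENNReal.one_ne_top prob_le_one).trans_eq ENNReal.toReal_one
  -- generating functions = tilted moments at positive mesh
  have hgen : ∀ v : nonemptyParts n → ℝ, ∀ᶠ j in atTop,
      (Summable (fun κ ↦ a j κ * ∏ i, v i ^ κ i) ∧
          tilt zEns x r R (ext v) (δs j) = ∑' κ, a j κ * ∏ i, v i ^ κ i) ∧
        (Summable (fun κ ↦ b j κ * ∏ i, v i ^ κ i) ∧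
          tilt tEns x r R (ext v) (δs j) = ∑' κ, b j κ * ∏ i, v i ^ κ i) := by
    intro v
    filter_upwards [hpos] with j hj
    have hZ := tilt_eq_tsum zEns zEns_mem hj x r R (ext v)
    have hT := tilt_eq_tsum tEns tEns_mem hj x r R (ext v)
    simp only [hext_apply] at hZ hT
    exact ⟨hZ, hT⟩
  have key := tendsto_coeff_sub_of_tsum (a := a) (b := b) (fun j κ ↦ ENNReal.toReal_nonneg)
    (fun j κ ↦ ENNReal.toReal_nonneg) (fun j κ ↦ hle1 _ _) (fun j κ ↦ hle1 _ _) hU'o hU'ne hU'pos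
    (fun v hv ↦ ?_) (fun v hv ↦ ?_) (fun i ↦ k i)
  · -- conclusion: `cyl` is the coefficient at `κ = k ∘ val`
    have hfun : (fun δ ↦ cyl zEns x r R k δ - cyl tEns x r R k δ) ∘ δs =
        fun j ↦ a j (fun i ↦ k i) - b j (fun i ↦ k i) := by
      funext j
      simp only [Function.comp_apply, cyl, ha, hb, setOf_forall_nonempty_eq]
    rw [hfun]
    exact key
  · -- eventual bounds
    obtain ⟨M, hM⟩ := (hU (ext v) hv).1
    refine ⟨M, ?_⟩
    filter_upwards [hδs.eventually hM, hgen v] with j hj hg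
    exact ⟨⟨hg.1.1, hg.1.2 ▸ hj.1⟩, ⟨hg.2.1, hg.2.2 ▸ hj.2⟩⟩
  · -- asymptotic equality
    refine ((hU (ext v) hv).2.comp hδs).congr' ?_
    filter_upwards [hgen v] with j hg
    rw [Function.comp_apply, hg.1.2, hg.2.2]

end Summit.CriticalPhenomena.CardyFormulaZ2.Cruxes.NestingRigidity.PositiveConeWeightDoubling

end
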